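import Literature.Geometry.Lorentzian.SchwarzschildDeSitterScalarModeStability
import HarnessLib

/-!
# Zero-frequency scalar modes on subextremal Kerr–de Sitter are the constants (theorems only)

Theorems only (no named facts, no new definitions). The printed statements formalised here are
[Hintz2021KdSModes, Corollary 1.2] "Moreover, for `σ = 0`, the only mode solutions are constants"
(printed for `|a/M| ≤ 1 − ε`, `ΛM² < δ`; here for EVERY subextremal `(M, a, Λ)`, in separated form)
and [Hintz2021KdSModes, §1.2 (p. 6)] "the zero mode can be analyzed using an integration by parts
argument as well" — for the separated `s = 0` master system of `KerrDeSitterMasterEquations.lean`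
(Casals–Teixeira da Costa (3.6)/(3.8) with Klein–Gordon switch `μ`; `μ = 0` the wave equation
`□_g`, `μ = 1` the conformal scalar = Teukolsky `s = 0`).

At `ω = 0` with `am = 0` one has `K ≡ 0`, the horizon exponents vanish (`horizonB = 0`: "ingoing" and
"outgoing" mean smooth at `r₊`, `r_c`), and the radial coefficient is the REAL function
`V(r) = −(2Λ/3)μr² − λ̄` (`masterRadialPotential_zeroFreq`). The angular eigenvalue at `ν = aω = 0`
is real and `≥ 0` (`masterAngularEigenvalue_nonneg_of_nu_zero`,
`SchwarzschildDeSitterScalarModeStability.lean`), and `> 0` when `m ≠ 0`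
(`masterAngularEigenvalue_re_pos_of_nu_zero`, the strict flux lemma). The integration by parts is
rendered, as everywhere in this directory, in boundary-flux form: `G = Re(Δ_r R' R̄)` has
`G' = Δ_r|R'|² + ((2Λ/3)μr² + λ̄)|R|² ≥ 0` and tends to `0` at both horizons (`Δ_r → 0`, `R`, `R'`
bounded), so `G' ≡ 0` (`flux_deriv_eq_zero_of_monotone`): `R' ≡ 0` and, if `R ≢ 0`, `μ = 0 = λ̄`.

Results (namespace `Literature.Geometry.Lorentzian.KerrDeSitter`):
* `masterRadial_zeroFreq_const` — the radial statement (`ω = 0`, `am = 0`, `μ ≥ 0`, `λ̄` real `≥ 0`):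
  an ingoing/outgoing solution is constant on `(r₊, r_c)`, and non-trivial only if `μ = 0 = λ̄`;
* `masterMode_zeroFreq` — a mode of the `s = 0` master system at `ω = 0` with `am = 0` and `μ ≥ 0`
  has `μ = 0`, `λ̄ = 0`, `m = 0` and constant radial function; `not_hasMasterMode_zeroFreq_of_pos`
  (`μ > 0`: no zero-frequency mode with `am = 0`, e.g. none for the conformal scalar),
  `not_hasMasterMode_zeroFreq_of_m_ne_zero` (any `a`, `μ ≥ 0`, `m ≠ 0`: none — for `a ≠ 0` this is
  `not_hasMasterMode_zero_omega_zero` of `KerrDeSitterRealFrequencyModes.lean`, for `a = 0` the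
  positivity of `λ̄`), `hasMasterMode_zeroFreq_imp` (★ `HasMasterMode M a Λ 0 μ 0 m → μ = 0 ∧ m = 0`
  for every `μ ≥ 0`);
* `hasMasterMode_wave_zeroFreq` — conversely the constants ARE zero-frequency `m = 0` modes of the wave
  equation (`μ = 0`, `λ̄ = 0`, `S ≡ 1`, `R ≡ 1`): the residual is genuine and exactly this;
* Teukolsky `s = 0` forms (`μ = 1`): `not_hasMode_zeroFreq` — ★ the conformal scalar has NO
  zero-frequency mode at all, any `m`, on any subextremal Kerr–de Sitter.

With `noMasterModeIn_zero_realAxis` / `noMasterModeIn_zero_realAxis_of_m_ne_zero` (real axis off the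
superradiant interval) this completes the printed Step-1 picture on the closed real axis for `s = 0`.

## References
* P. Hintz, *Mode stability and shallow quasinormal modes of Kerr–de Sitter black holes away from
  extremality*, J. Eur. Math. Soc. (2024), arXiv:2112.14431, Corollary 1.2 and §1.2 (p. 6). [Hintz2021KdSModes]
* M. Casals, R. Teixeira da Costa, Commun. Math. Phys. 394 (2022) 797–832, arXiv:2105.13329 v3,
  (3.6), (3.8), Definition 3.3, proof of Theorem 3.10 Step 1. [CasalsTeixeiradacosta2022]
-/

noncomputable section

open Complex Set Filter Topology

open scoped ComplexConjugate

namespace Literature.Geometry.Lorentzian.KerrDeSitter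

/-! ### Skeleton: a monotone flux with zero boundary values is constant -/

/-- A real function on `(lo, hi)` with non-negative derivative tending to `0` at both endpoints has
identically vanishing derivative (else `−G` would contradict `false_of_antitone_flux_Ioo`).
[cite: CasalsTeixeiradacosta2022, Theorem 3.10 (proof, Step 1)] -/
theorem flux_deriv_eq_zero_of_monotone {lo hi : ℝ} {G G' : ℝ → ℝ}
    (hderiv : ∀ x ∈ Ioo lo hi, HasDerivAt G (G' x) x) (hnonneg : ∀ x ∈ Ioo lo hi, 0 ≤ G' x)
    (hleft : Tendsto G (𝓝[>] lo) (𝓝 0)) (hright : Tendsto G (𝓝[<] hi) (𝓝 0)) :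
    ∀ x ∈ Ioo lo hi, G' x = 0 := by
  intro x hx
  by_contra hne
  have hpos : 0 < G' x := lt_of_le_of_ne (hnonneg x hx) (Ne.symm hne)
  refine false_of_antitone_flux_Ioo (G := fun y => -G y) (G' := fun y => -G' y)
    (fun y hy => (hderiv y hy).neg) (fun y hy => by simpa using hnonneg y hy)
    ⟨x, hx, by simpa using hpos⟩ ?_ ?_
  · simpa using hleft.neg
  · simpa using hright.neg

/-! ### The data at zero frequency: `K = 0`, `B(r_h) = 0`, real radial coefficient -/

/-- `K(r) = ω(r² + a²) − am` vanishes identically at `ω = 0`, `am = 0`. [cite: Hatsuda2020, (2.14)] -/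
theorem radialK_zeroFreq {a m : ℝ} (ham : a * m = 0) (r : ℝ) : radialK a 0 m r = 0 := by
  simp [radialK, ham]

/-- The horizon exponents vanish at `ω = 0`, `am = 0`: `B(r_h) = iΞK(r_h)/Δ_r'(r_h) = 0`.
[cite: Hatsuda2020, (2.18)] -/
theorem horizonB_zeroFreq (M : ℝ) {a : ℝ} (Λ : ℝ) {m : ℝ} (ham : a * m = 0) (rh : ℝ) :
    horizonB M a Λ 0 m rh = 0 := by
  simp [horizonB, radialK_zeroFreq ham]

/-- At `ω = 0`, `am = 0`, `s = 0` the radial master coefficient (CTdC (3.8)) is the real function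
`−(2Λ/3)μr² − λ̄`. [cite: CasalsTeixeiradacosta2022, (3.8)] -/
theorem masterRadialPotential_zeroFreq (M : ℝ) {a : ℝ} (Λ μ : ℝ) {m : ℝ} (ham : a * m = 0)
    (lamBar : ℂ) (r : ℝ) :
    masterRadialPotential M a Λ 0 μ 0 m lamBar r = -(((2 * (Λ / 3) * μ * r ^ 2 : ℝ) : ℂ)) - lamBar := by
  simp only [masterRadialPotential, radialK_zeroFreq ham]
  push_cast
  ring

/-- Real part of the derivative of the flux `Δ R' R̄` (pure algebra): for real `c`, `P`,
`Re((c + λ̄)|z|² + P|z'|²) = P|z'|² + (c + Re λ̄)|z|²`. [cite: CasalsTeixeiradacosta2022, Theorem 3.10 (proof, Step 1)] -/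
theorem re_fluxDeriv_zeroFreq (c P : ℝ) (lamBar z z' : ℂ) :
    ((((c : ℝ) : ℂ) + lamBar) * (z * conj z) + (P : ℂ) * (z' * conj z')).re =
      P * normSq z' + (c + lamBar.re) * normSq z := by
  rw [Complex.mul_conj, Complex.mul_conj]
  simp only [add_re, mul_re, ofReal_re, ofReal_im, Complex.ofReal_re, Complex.ofReal_im]
  ring

/-! ### The angular eigenvalue at `ν = 0` is positive when `m ≠ 0` -/

/-- At `ν = 0`, `s = 0`, `Λ ≥ 0`, `μ ≥ 0` and `m ≠ 0` every angular eigenvalue has `Re λ̄ > 0` (indeed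
`λ̄ ≥ l(l+1) ≥ |m|(|m|+1)` classically; here the weak form): the strict flux lemma
`im_conj_mul_neg_of_angularODE` at `c = i`, the pointwise term `N(x) = Ξ²m²/((1−x²)Δ_θ) + 2αx²μ`
being positive everywhere. [cite: CasalsTeixeiradacosta2022, Lemma 3.1 (proof)] -/
theorem masterAngularEigenvalue_re_pos_of_nu_zero {a Λ μ : ℝ} (hΛ : 0 ≤ Λ) (hμ : 0 ≤ μ) {m : ℝ}
    (hm : m ≠ 0) {lamBar : ℂ} (h : IsMasterAngularEigenvalue a Λ 0 μ 0 m lamBar) :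
    0 < lamBar.re := by
  obtain ⟨S, ⟨S', S'', hS⟩, hreg, hnt⟩ := h
  have hα : 0 ≤ alpha a Λ := by unfold alpha; positivity
  have hξ : 0 < xi a Λ := xi_pos hΛ a
  have hN : ∀ x ∈ Ioo (-1 : ℝ) 1, 0 < 2 * alpha a Λ * x ^ 2 * (μ + 2 * (0 : ℝ) ^ 2) +
      (xi a Λ * m + 0 * x * (xi a Λ - 2 * alpha a Λ * (1 - x ^ 2))) ^ 2 /
        ((1 - x ^ 2) * (1 + alpha a Λ * x ^ 2)) := by
    intro x hx
    have hx2 : 0 < 1 - x ^ 2 := by nlinarith [hx.1, hx.2]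
    have h1 : 0 ≤ 2 * alpha a Λ * x ^ 2 * (μ + 2 * (0 : ℝ) ^ 2) := by positivity
    have h2 : 0 < (xi a Λ * m + 0 * x * (xi a Λ - 2 * alpha a Λ * (1 - x ^ 2))) ^ 2 /
        ((1 - x ^ 2) * (1 + alpha a Λ * x ^ 2)) := by
      have hnum : 0 < (xi a Λ * m + 0 * x * (xi a Λ - 2 * alpha a Λ * (1 - x ^ 2))) ^ 2 := by
        have : xi a Λ * m ≠ 0 := mul_ne_zero hξ.ne' hm
        simpa using sq_pos_of_ne_zero this
      positivity
    linarith
  have hI : 0 < (I : ℂ).im := by simp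
  have key := im_conj_mul_neg_of_angularODE hα hI (s := 0) (m := m)
    (V := fun x => masterAngularPotential a Λ 0 μ 0 m lamBar x) (lamBar := lamBar) hS hreg hnt ?_ ?_
  · rw [mul_im, conj_re, conj_im, I_re, I_im] at key
    linarith
  · intro x hx
    have e : masterAngularPotential a Λ 0 μ 0 m lamBar x - lamBar =
        -((2 * alpha a Λ * x ^ 2 * (μ + 2 * (0 : ℝ) ^ 2) +
          (xi a Λ * m + 0 * x * (xi a Λ - 2 * alpha a Λ * (1 - x ^ 2))) ^ 2 /
            ((1 - x ^ 2) * (1 + alpha a Λ * x ^ 2)) : ℝ) : ℂ) := by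
      rw [masterAngularPotential_sub]; ring
    show 0 ≤ (conj I * (masterAngularPotential a Λ 0 μ 0 m lamBar x - lamBar)).im
    rw [e, mul_neg, Complex.neg_im, mul_im, conj_re, conj_im, I_re, I_im, ofReal_re, ofReal_im]
    have := hN x hx
    nlinarith
  · intro x hx _
    have e : masterAngularPotential a Λ 0 μ 0 m lamBar x - lamBar =
        -((2 * alpha a Λ * x ^ 2 * (μ + 2 * (0 : ℝ) ^ 2) +
          (xi a Λ * m + 0 * x * (xi a Λ - 2 * alpha a Λ * (1 - x ^ 2))) ^ 2 /
            ((1 - x ^ 2) * (1 + alpha a Λ * x ^ 2)) : ℝ) : ℂ) := by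
      rw [masterAngularPotential_sub]; ring
    show 0 < (conj I * (masterAngularPotential a Λ 0 μ 0 m lamBar x - lamBar)).im
    rw [e, mul_neg, Complex.neg_im, mul_im, conj_re, conj_im, I_re, I_im, ofReal_re, ofReal_im]
    have := hN x hx
    nlinarith

/-! ### The radial statement at zero frequency -/

/-- **Zero-frequency radial solutions are constant.** On subextremal Kerr–de Sitter let `R` solve the
`s = 0` radial master equation at `ω = 0` with `am = 0` (so `K ≡ 0`), Klein–Gordon switch `μ ≥ 0` and
real separation constant `λ̄ ≥ 0`, ingoing at `𝓗⁺` and outgoing at `𝓗⁺_c` (at these parameters: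
smooth at both horizons). Then `R` is constant on `(r₊, r_c)`, and if `R ≢ 0` then `μ = 0` and
`λ̄ = 0`. Boundary-flux form of "the zero mode can be analyzed using an integration by parts
argument": `G = Re(Δ_r R' R̄)`, `G' = Δ_r|R'|² + ((2Λ/3)μr² + λ̄)|R|² ≥ 0`, `G → 0` at `r₊`, `r_c`.
[cite: Hintz2021KdSModes, §1.2] -/
theorem masterRadial_zeroFreq_const {M a Λ μ : ℝ} {m : ℝ} {lamBar : ℂ} (hsub : IsSubextremal M a Λ)
    (ham : a * m = 0) (hμ : 0 ≤ μ) (hlamIm : lamBar.im = 0) (hlamRe : 0 ≤ lamBar.re) {R : ℝ → ℂ}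
    (hR : IsMasterRadialSolution M a Λ 0 μ 0 m lamBar R)
    (hin : IsIngoingAtEventHorizon M a Λ 0 0 m R) (hout : IsOutgoingAtCosmoHorizon M a Λ 0 m R) :
    (∀ r ∈ Ioo (rPlus M a Λ) (rCosmo M a Λ), ∀ r' ∈ Ioo (rPlus M a Λ) (rCosmo M a Λ), R r = R r') ∧
      ((∃ r ∈ Ioo (rPlus M a Λ) (rCosmo M a Λ), R r ≠ 0) → μ = 0 ∧ lamBar = 0) := by
  have h1top : (1 : WithTop ℕ∞) ≤ ((⊤ : ℕ∞) : WithTop ℕ∞) := by exact_mod_cast le_top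
  have h0top : ((⊤ : ℕ∞) : WithTop ℕ∞) ≠ 0 := by simp
  obtain ⟨hM, hΛ, h01, h12, hΔ1, hΔ2, -, hΔpos, -⟩ := id hsub
  have hr₁ : 0 < rPlus M a Λ := lt_of_le_of_lt (rMinus_nonneg M a Λ) h01
  set lo := rPlus M a Λ with hlo
  set hi := rCosmo M a Λ with hhi
  obtain ⟨R', R'', hode⟩ := hR
  have hV := masterRadialPotential_zeroFreq M Λ μ ham lamBar
  have hB1 : horizonB M a Λ 0 m lo = 0 := horizonB_zeroFreq M Λ ham lo
  have hB2 : horizonB M a Λ 0 m hi = 0 := horizonB_zeroFreq M Λ ham hi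
  -- the flux and its derivative
  set c : ℝ → ℝ := fun r => 2 * (Λ / 3) * μ * r ^ 2 with hc
  set G : ℝ → ℝ := fun r => (((delta M a Λ r : ℝ) : ℂ) * R' r * conj (R r)).re with hG
  set G' : ℝ → ℝ := fun r => delta M a Λ r * normSq (R' r) + (c r + lamBar.re) * normSq (R r)
    with hG'
  have hderiv : ∀ r ∈ Ioo lo hi, HasDerivAt G (G' r) r := by
    intro r hr
    obtain ⟨hd1, hd2, hode_r⟩ := hode r hr
    have e1 : (((0 : ℝ) + 1 : ℝ) : ℂ) = 1 := by norm_num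
    rw [hV r, e1, one_mul] at hode_r
    have hΔ' : HasDerivAt (fun x => ((delta M a Λ x : ℝ) : ℂ)) ((deltaDeriv M a Λ r : ℝ) : ℂ) r :=
      (hasDerivAt_delta M a Λ r).ofReal_comp
    have hRbar : HasDerivAt (fun x => conj (R x)) (conj (R' r)) r := by simpa using hd1.star
    have hprod := (hΔ'.fun_mul hd2).fun_mul hRbar
    have hF : HasDerivAt (fun x => ((delta M a Λ x : ℝ) : ℂ) * R' x * conj (R x))
        ((((c r : ℝ) : ℂ) + lamBar) * (R r * conj (R r)) +
          ((delta M a Λ r : ℝ) : ℂ) * (R' r * conj (R' r))) r := by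
      refine hprod.congr_deriv ?_
      simp only [hc]
      linear_combination (conj (R r)) * hode_r
    have hre := Complex.reCLM.hasFDerivAt.comp_hasDerivAt r hF
    have e2 : (Complex.reCLM : ℂ →L[ℝ] ℝ) ((((c r : ℝ) : ℂ) + lamBar) * (R r * conj (R r)) +
        ((delta M a Λ r : ℝ) : ℂ) * (R' r * conj (R' r))) = G' r := by
      rw [Complex.reCLM_apply, re_fluxDeriv_zeroFreq]
    rw [e2] at hre
    exact hre
  have hnonneg : ∀ r ∈ Ioo lo hi, 0 ≤ G' r := by
    intro r hr
    have hcr : 0 ≤ c r := by simp only [hc]; positivity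
    have t1 := mul_nonneg (hΔpos r hr).le (normSq_nonneg (R' r))
    have t2 := mul_nonneg (add_nonneg hcr hlamRe) (normSq_nonneg (R r))
    simp only [hG']
    linarith
  -- near `r₊`: `R = f` smooth, `R' = f'`
  obtain ⟨ε₁, hε₁, f, hf, hRf⟩ := hin
  have hRf' : ∀ r ∈ Ioo lo (lo + ε₁), R r = f r := by
    intro r hr
    have := hRf r hr
    rw [hB1] at this
    simpa using this
  have hU1 : IsOpen (Ioo (lo - ε₁) (lo + ε₁)) := isOpen_Ioo
  have hlo1 : lo ∈ Ioo (lo - ε₁) (lo + ε₁) := ⟨by linarith, by linarith⟩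
  have hfd : DifferentiableOn ℝ f (Ioo (lo - ε₁) (lo + ε₁)) := hf.differentiableOn h0top
  have hfc : ContinuousAt f lo :=
    (hfd.continuousOn.continuousWithinAt hlo1).continuousAt (hU1.mem_nhds hlo1)
  have hf'c : ContinuousAt (deriv f) lo :=
    ((hf.continuousOn_deriv_of_isOpen hU1 h1top).continuousWithinAt hlo1).continuousAt
      (hU1.mem_nhds hlo1)
  have hδ₁ : 0 < min ε₁ (hi - lo) := lt_min hε₁ (by linarith)
  have hR'f : ∀ r ∈ Ioo lo (lo + min ε₁ (hi - lo)), R' r = deriv f r := by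
    intro r hr
    have hrI : r ∈ Ioo lo hi := ⟨hr.1, by linarith [min_le_right ε₁ (hi - lo), hr.2]⟩
    have hrε : r ∈ Ioo lo (lo + ε₁) := ⟨hr.1, by linarith [min_le_left ε₁ (hi - lo), hr.2]⟩
    have hrU : r ∈ Ioo (lo - ε₁) (lo + ε₁) := ⟨by linarith [hrε.1], hrε.2⟩
    have hfr : HasDerivAt f (deriv f r) r :=
      ((hfd r hrU).differentiableAt (hU1.mem_nhds hrU)).hasDerivAt
    have heq : R =ᶠ[𝓝 r] f :=
      Filter.eventually_of_mem (isOpen_Ioo.mem_nhds hrε) fun y hy => hRf' y hy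
    exact (hode r hrI).1.unique (hfr.congr_of_eventuallyEq heq)
  have hleft : Tendsto G (𝓝[>] lo) (𝓝 0) := by
    have hΔc : ContinuousAt (fun r => delta M a Λ r) lo := (hasDerivAt_delta M a Λ lo).continuousAt
    have hlim : Tendsto (fun r => (((delta M a Λ r : ℝ) : ℂ) * deriv f r * conj (f r)).re) (𝓝 lo)
        (𝓝 ((((delta M a Λ lo : ℝ) : ℂ) * deriv f lo * conj (f lo)).re)) := by
      have h := (hΔc.ofReal.mul hf'c).mul (Complex.continuous_conj.continuousAt.comp hfc)
      exact (Complex.continuous_re.continuousAt.comp h).tendsto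
    rw [show delta M a Λ lo = 0 from hΔ1] at hlim
    simp only [Complex.ofReal_zero, zero_mul, Complex.zero_re] at hlim
    refine (hlim.mono_left nhdsWithin_le_nhds).congr' ?_
    filter_upwards [Ioo_mem_nhdsGT (show lo < lo + min ε₁ (hi - lo) by linarith)] with r hr
    have hrε : r ∈ Ioo lo (lo + ε₁) := ⟨hr.1, by linarith [min_le_left ε₁ (hi - lo), hr.2]⟩
    simp only [hG]
    rw [hR'f r hr, hRf' r hrε]
  -- near `r_c`: `R = g` smooth, `R' = g'`
  obtain ⟨ε₂, hε₂, g, hg, hRg⟩ := hout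
  have hRg' : ∀ r ∈ Ioo (hi - ε₂) hi, R r = g r := by
    intro r hr
    have := hRg r hr
    rw [hB2] at this
    simpa using this
  have hU2 : IsOpen (Ioo (hi - ε₂) (hi + ε₂)) := isOpen_Ioo
  have hhi2 : hi ∈ Ioo (hi - ε₂) (hi + ε₂) := ⟨by linarith, by linarith⟩
  have hgd : DifferentiableOn ℝ g (Ioo (hi - ε₂) (hi + ε₂)) := hg.differentiableOn h0top
  have hgc : ContinuousAt g hi :=
    (hgd.continuousOn.continuousWithinAt hhi2).continuousAt (hU2.mem_nhds hhi2)
  have hg'c : ContinuousAt (deriv g) hi :=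
    ((hg.continuousOn_deriv_of_isOpen hU2 h1top).continuousWithinAt hhi2).continuousAt
      (hU2.mem_nhds hhi2)
  have hδ₂ : 0 < min ε₂ (hi - lo) := lt_min hε₂ (by linarith)
  have hR'g : ∀ r ∈ Ioo (hi - min ε₂ (hi - lo)) hi, R' r = deriv g r := by
    intro r hr
    have hrI : r ∈ Ioo lo hi := ⟨by linarith [min_le_right ε₂ (hi - lo), hr.1], hr.2⟩
    have hrε : r ∈ Ioo (hi - ε₂) hi := ⟨by linarith [min_le_left ε₂ (hi - lo), hr.1], hr.2⟩
    have hrU : r ∈ Ioo (hi - ε₂) (hi + ε₂) := ⟨hrε.1, by linarith [hrε.2]⟩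
    have hgr : HasDerivAt g (deriv g r) r :=
      ((hgd r hrU).differentiableAt (hU2.mem_nhds hrU)).hasDerivAt
    have heq : R =ᶠ[𝓝 r] g :=
      Filter.eventually_of_mem (isOpen_Ioo.mem_nhds hrε) fun y hy => hRg' y hy
    exact (hode r hrI).1.unique (hgr.congr_of_eventuallyEq heq)
  have hright : Tendsto G (𝓝[<] hi) (𝓝 0) := by
    have hΔc : ContinuousAt (fun r => delta M a Λ r) hi := (hasDerivAt_delta M a Λ hi).continuousAt
    have hlim : Tendsto (fun r => (((delta M a Λ r : ℝ) : ℂ) * deriv g r * conj (g r)).re) (𝓝 hi)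
        (𝓝 ((((delta M a Λ hi : ℝ) : ℂ) * deriv g hi * conj (g hi)).re)) := by
      have h := (hΔc.ofReal.mul hg'c).mul (Complex.continuous_conj.continuousAt.comp hgc)
      exact (Complex.continuous_re.continuousAt.comp h).tendsto
    rw [show delta M a Λ hi = 0 from hΔ2] at hlim
    simp only [Complex.ofReal_zero, zero_mul, Complex.zero_re] at hlim
    refine (hlim.mono_left nhdsWithin_le_nhds).congr' ?_
    filter_upwards [Ioo_mem_nhdsLT (show hi - min ε₂ (hi - lo) < hi by linarith)] with r hr
    have hrε : r ∈ Ioo (hi - ε₂) hi := ⟨by linarith [min_le_left ε₂ (hi - lo), hr.1], hr.2⟩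
    simp only [hG]
    rw [hR'g r hr, hRg' r hrε]
  -- `G' ≡ 0`: `R' ≡ 0` and `((2Λ/3)μr² + λ̄)|R|² ≡ 0`
  have hzero := flux_deriv_eq_zero_of_monotone hderiv hnonneg hleft hright
  have hR'0 : ∀ r ∈ Ioo lo hi, R' r = 0 := by
    intro r hr
    have h := hzero r hr
    simp only [hG'] at h
    have hcr : 0 ≤ c r := by simp only [hc]; positivity
    have t1 := mul_nonneg (hΔpos r hr).le (normSq_nonneg (R' r))
    have t2 := mul_nonneg (add_nonneg hcr hlamRe) (normSq_nonneg (R r))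
    have h1 : delta M a Λ r * normSq (R' r) = 0 := by linarith
    have h2 : normSq (R' r) = 0 := by
      rcases mul_eq_zero.1 h1 with h | h
      · exact absurd h (hΔpos r hr).ne'
      · exact h
    exact Complex.normSq_eq_zero.1 h2
  have hconst : ∀ r ∈ Ioo lo hi, ∀ r' ∈ Ioo lo hi, R r = R r' := by
    intro r hr r' hr'
    have key := Convex.norm_image_sub_le_of_norm_hasDerivWithin_le (f := R) (f' := R') (C := 0)
      (s := Ioo lo hi) (fun x hx => (hode x hx).1.hasDerivWithinAt)
      (fun x hx => by rw [hR'0 x hx, norm_zero]) (convex_Ioo lo hi) hr hr'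
    rw [zero_mul] at key
    exact (norm_sub_eq_zero_iff.1 (le_antisymm key (norm_nonneg _))).symm
  refine ⟨hconst, ?_⟩
  rintro ⟨r₀, hr₀, hR₀⟩
  have h := hzero r₀ hr₀
  simp only [hG'] at h
  rw [hR'0 r₀ hr₀, map_zero, mul_zero, zero_add] at h
  have hn : 0 < normSq (R r₀) := Complex.normSq_pos.2 hR₀
  have hsum : c r₀ + lamBar.re = 0 := by
    rcases mul_eq_zero.1 h with h' | h'
    · exact h'
    · exact absurd h' hn.ne'
  have hcr : 0 ≤ c r₀ := by simp only [hc]; positivity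
  have hc0 : c r₀ = 0 := by linarith
  have hre0 : lamBar.re = 0 := by linarith
  have hr0pos : 0 < r₀ := hr₁.trans hr₀.1
  have hμ0 : μ = 0 := by
    simp only [hc] at hc0
    have : 2 * (Λ / 3) * r₀ ^ 2 ≠ 0 := by positivity
    have e : 2 * (Λ / 3) * μ * r₀ ^ 2 = μ * (2 * (Λ / 3) * r₀ ^ 2) := by ring
    rw [e] at hc0
    rcases mul_eq_zero.1 hc0 with h' | h'
    · exact h'
    · exact absurd h' this
  exact ⟨hμ0, Complex.ext (by simpa using hre0) (by simpa using hlamIm)⟩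

/-! ### Mode-level statements -/

/-- **A zero-frequency `s = 0` mode with `am = 0` has `μ = 0`, `λ̄ = 0` and constant radial function**
(every subextremal Kerr–de Sitter, every `μ ≥ 0`). [cite: Hintz2021KdSModes, Corollary 1.2] -/
theorem masterMode_zeroFreq {M a Λ μ : ℝ} {m : ℝ} {lamBar : ℂ} {R : ℝ → ℂ}
    (hsub : IsSubextremal M a Λ) (ham : a * m = 0) (hμ : 0 ≤ μ)
    (hmode : IsMasterModeSolution M a Λ 0 μ 0 m lamBar R) :
    μ = 0 ∧ lamBar = 0 ∧
      ∀ r ∈ Ioo (rPlus M a Λ) (rCosmo M a Λ), ∀ r' ∈ Ioo (rPlus M a Λ) (rCosmo M a Λ), R r = R r' := by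
  obtain ⟨hang, hR, hin, hout, hnt⟩ := hmode
  have hν : (a : ℂ) * 0 = 0 := mul_zero _
  rw [hν] at hang
  have hμ' : 0 ≤ μ + 2 * (0 : ℝ) ^ 2 := by simpa using hμ
  obtain ⟨hIm, hRe⟩ := masterAngularEigenvalue_nonneg_of_nu_zero hsub.2.1.le hμ' hang
  obtain ⟨hconst, hnz⟩ := masterRadial_zeroFreq_const hsub ham hμ hIm hRe hR hin hout
  obtain ⟨h0, h1⟩ := hnz hnt
  exact ⟨h0, h1, hconst⟩

/-- **No zero-frequency `s = 0` mode with `am = 0` when `μ > 0`** (e.g. the conformal scalar `μ = 1`,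
or any positive Klein–Gordon mass): every subextremal Kerr–de Sitter. [cite: Hintz2021KdSModes, Corollary 1.2] -/
theorem not_hasMasterMode_zeroFreq_of_pos {M a Λ μ : ℝ} {m : ℝ} (hsub : IsSubextremal M a Λ)
    (ham : a * m = 0) (hμ : 0 < μ) : ¬HasMasterMode M a Λ 0 μ 0 m := by
  rintro ⟨lamBar, R, hmode⟩
  have h := (masterMode_zeroFreq hsub ham hμ.le hmode).1
  exact hμ.ne' h

/-- **No zero-frequency `s = 0` mode with `m ≠ 0`**, on every subextremal Kerr–de Sitter and for every
`μ ≥ 0`: for `a ≠ 0` this is `not_hasMasterMode_zero_omega_zero` (`K = −am ≠ 0`, boundary pairing);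
for `a = 0` the angular eigenvalue at `ν = 0` is positive (`masterAngularEigenvalue_re_pos_of_nu_zero`)
while a non-trivial zero-frequency solution forces `λ̄ = 0`. [cite: Hintz2021KdSModes, Corollary 1.2] -/
theorem not_hasMasterMode_zeroFreq_of_m_ne_zero {M a Λ μ : ℝ} {m : ℝ} (hsub : IsSubextremal M a Λ)
    (hμ : 0 ≤ μ) (hm : m ≠ 0) : ¬HasMasterMode M a Λ 0 μ 0 m := by
  by_cases ha : a = 0
  · rintro ⟨lamBar, R, hmode⟩
    have ham : a * m = 0 := by rw [ha, zero_mul]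
    have hang := hmode.1
    have hν : (a : ℂ) * 0 = 0 := mul_zero _
    rw [hν] at hang
    have hpos := masterAngularEigenvalue_re_pos_of_nu_zero hsub.2.1.le hμ hm hang
    have h0 := (masterMode_zeroFreq hsub ham hμ hmode).2.1
    rw [h0] at hpos
    simp at hpos
  · exact not_hasMasterMode_zero_omega_zero hsub ha hm

/-- ★ **Zero-frequency `s = 0` modes exist only for the massless field and `m = 0`**: on every
subextremal Kerr–de Sitter, for every `μ ≥ 0`, `HasMasterMode M a Λ 0 μ 0 m → μ = 0 ∧ m = 0` (and
then the radial function is constant, `masterMode_zeroFreq`). Printed: "Moreover, for `σ = 0`, the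
only mode solutions are constants." [cite: Hintz2021KdSModes, Corollary 1.2] -/
theorem hasMasterMode_zeroFreq_imp {M a Λ μ : ℝ} {m : ℝ} (hsub : IsSubextremal M a Λ) (hμ : 0 ≤ μ)
    (h : HasMasterMode M a Λ 0 μ 0 m) : μ = 0 ∧ m = 0 := by
  by_cases hm : m = 0
  · subst hm
    obtain ⟨lamBar, R, hmode⟩ := h
    exact ⟨(masterMode_zeroFreq hsub (mul_zero a) hμ hmode).1, rfl⟩
  · exact absurd h (not_hasMasterMode_zeroFreq_of_m_ne_zero hsub hμ hm)

/-- **The constants ARE zero-frequency modes of the wave equation** (`μ = 0`, `m = 0`, `λ̄ = 0`,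
`S ≡ 1`, `R ≡ 1`) on every subextremal Kerr–de Sitter — so the residual `{ω = 0, m = 0}` of the
massless column is genuine and consists exactly of them. [cite: Hintz2021KdSModes, Corollary 1.2] -/
theorem hasMasterMode_wave_zeroFreq {M a Λ : ℝ} (hsub : IsSubextremal M a Λ) :
    HasMasterMode M a Λ 0 0 0 0 := by
  obtain ⟨hM, hΛ, h01, h12, -⟩ := id hsub
  have hcd : ∀ (U : Set ℝ), ContDiffOn ℝ ((⊤ : ℕ∞) : WithTop ℕ∞) (fun _ : ℝ => (1 : ℂ)) U :=
    fun U => contDiffOn_const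
  refine ⟨0, fun _ => 1, ?_, ?_, ?_, ?_, ?_⟩
  · -- angular: `S ≡ 1` is a regular eigenfunction with `λ̄ = 0` at `ν = 0`, `m = 0`, `μ = 0`
    refine ⟨fun _ => 1, ⟨fun _ => 0, fun _ => 0, fun x hx => ?_⟩, ?_, ⟨0, by norm_num, by simp⟩⟩
    · refine ⟨hasDerivAt_const x (1 : ℂ), hasDerivAt_const x (0 : ℂ), ?_⟩
      simp [masterAngularPotential]
    · refine ⟨⟨1, one_pos, fun _ => 1, hcd _, fun x hx => ?_⟩, ⟨1, one_pos, fun _ => 1, hcd _, fun x hx => ?_⟩⟩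
      · simp
      · simp
  · -- radial: `R ≡ 1` solves the equation with coefficient `−(2Λ/3)·0·r² − 0 = 0`
    refine ⟨fun _ => 0, fun _ => 0, fun r hr => ⟨hasDerivAt_const r (1 : ℂ), hasDerivAt_const r (0 : ℂ), ?_⟩⟩
    rw [masterRadialPotential_zeroFreq M Λ 0 (mul_zero a) 0 r]
    simp
  · refine ⟨1, one_pos, fun _ => 1, hcd _, fun r hr => ?_⟩
    rw [horizonB_zeroFreq M Λ (mul_zero a)]
    simp
  · refine ⟨1, one_pos, fun _ => 1, hcd _, fun r hr => ?_⟩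
    rw [horizonB_zeroFreq M Λ (mul_zero a)]
    simp
  · exact ⟨(rPlus M a Λ + rCosmo M a Λ) / 2, ⟨by linarith, by linarith⟩, by simp⟩

/-! ### Teukolsky `s = 0` (conformal scalar, `μ = 1`) -/

/-- ★ **The conformal scalar (Teukolsky `s = 0`) has no zero-frequency mode at all** — any `m`, any
subextremal Kerr–de Sitter (`μ = 1 > 0` kills `m = 0`; `m ≠ 0` by the previous theorem).
[cite: Hintz2021KdSModes, Corollary 1.2] -/
theorem not_hasMode_zeroFreq {M a Λ : ℝ} (hsub : IsSubextremal M a Λ) (m : ℝ) :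
    ¬HasMode M a Λ 0 0 m := by
  rw [← hasMasterMode_one_iff M a Λ 0 hsub.2.1.le]
  intro h
  have := (hasMasterMode_zeroFreq_imp hsub zero_le_one h).1
  norm_num at this

/-- Window form for the conformal scalar: `NoModeIn M a Λ 0 {ω = 0}` on every subextremal
Kerr–de Sitter. [cite: Hintz2021KdSModes, Corollary 1.2] -/
theorem noModeIn_zero_zeroFreq {M a Λ : ℝ} (hsub : IsSubextremal M a Λ) :
    NoModeIn M a Λ 0 {q | q.1 = 0} := by
  rintro ω m hq _ hmode
  have hω : ω = 0 := hq
  subst hω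
  exact not_hasMode_zeroFreq hsub m hmode

/-- Window form for the master system, `μ > 0`: `NoMasterModeIn M a Λ 0 μ {ω = 0}`.
[cite: Hintz2021KdSModes, Corollary 1.2] -/
theorem noMasterModeIn_zeroFreq_of_pos {M a Λ μ : ℝ} (hsub : IsSubextremal M a Λ) (hμ : 0 < μ) :
    NoMasterModeIn M a Λ 0 μ {q | q.1 = 0} := by
  rintro ω m hq _ hmode
  have hω : ω = 0 := hq
  subst hω
  exact hμ.ne' (hasMasterMode_zeroFreq_imp hsub hμ.le hmode).1

/-- Window form for the wave equation (`μ = 0`): `NoMasterModeIn M a Λ 0 0 {ω = 0, m ≠ 0}` — the only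
zero-frequency modes of `□_g` are axisymmetric (and constant). [cite: Hintz2021KdSModes, Corollary 1.2] -/
theorem noMasterModeIn_wave_zeroFreq {M a Λ : ℝ} (hsub : IsSubextremal M a Λ) :
    NoMasterModeIn M a Λ 0 0 {q | q.1 = 0 ∧ q.2 ≠ 0} := by
  rintro ω m ⟨hω, hm⟩ _ hmode
  dsimp only at hω hm
  subst hω
  exact hm (hasMasterMode_zeroFreq_imp hsub le_rfl hmode).2

end Literature.Geometry.Lorentzian.KerrDeSitter

end
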